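import Summits.QuantumFields.BalabanUV.T4Continuum.Support.CovariantVectorCTDefects
import Summits.QuantumFields.BalabanUV.T4Continuum.Support.CovariantVectorGreenOfField
import Literature.MathematicalPhysics.QuantumFieldTheory.Balaban1983to89.Beta.DeltaACombesThomasSets
import Summits.QuantumFields.BalabanUV.Beta.AccretiveCombesThomas

/-!
# T⁴ programme, SUBSTRATE (shared lattice-gauge analysis library) — LEVEL-FREE DECAY OF THE INVERSE OF THE COVARIANT VECTOR OPERATOR
# `V_R = Δ_R + a′n^dQ_k(R)ᴴQ_k(R)` and of p1's `greenOf = (deltaQOf …)⁻¹` at regular backgrounds: pairing, set-to-set and ENTRY decay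
# `‖V_R⁻¹(i, i′)‖ ≤ (2/γ_V)·e^{−κ_V·dist_∞(x, x′)/n}` with `(γ_V, κ_V)` depending on `(card o, d, a′, α, τ)` only (junction J-3b of MAP v0.4 §O1 O-3′)

Substrate cell `b2b-balaban-substrate-*`, seat p3 (typer NEXT v0.4 item 2: «entry decay of `(deltaQOf c a Γ U)⁻¹` at regular backgrounds»).
From J-1 (`coercive_vecOp`, `gammaV`), J-2 (`ctRowDefect_vecOp_le`, `Jvec`) and the tree's Combes–Thomas engine
(`Beta.DeltaACombesThomas.combesThomas_pairwise_inv`) with the distance-to-the-source weight of `Beta.DeltaACombesThomasSets`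
(`rhoT T hT (1/n)`: `1/n`-Lipschitz by `rhoT_lipschitz`, stencil oscillation `≤ 2(d+1)` by `stencil_osc_of_lipschitz`):
 * **`vecOp_inv_pairing_decay`** (any bond weight with the two letters, any `κ ≥ 0` with `Jvec κ (2(d+1))`-type budget `< γ_V`);
 * **`vecOp_inv_setDecay`** (`v` on the source `T`, `u` at sup-distance `≥ nR`: `|⟨u, V_R⁻¹v⟩| ≤ e^{−κR}/(γ_V − Jvec)·‖u‖‖v‖`),
   **`vecOp_inv_entry_decay`** (`‖V_R⁻¹(i,i′)‖ ≤ e^{−κ·dist_∞(x,x′)/n}/(γ_V − Jvec)`);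
 * the explicit admissible rate **`kappaV co d a′ α τ = min 1 (γ_V/(2(BV+1)))`** with the linear budget bound `Jvec_le_linear` (`Jvec κ ≤ BV·κ` on
   `[0,1]`, `BV = 2co·d(1+α) + a′co²(1+τ)²·2(d+1)²e^{2(d+1)²}`), `Jvec_kappaV_le` (`≤ γ_V/2`) and **`vecOp_inv_entry_decay_explicit`**:
   `‖V_R⁻¹(i,i′)‖ ≤ (2/γ_V)·e^{−κ_V·dist_∞(x,x′)/n}`;
 * the READING at the operator of record: **`greenOf_entry_decay_of_regular`** — for a V1 gauge field `U` with `lev·dist1(U b) ≤ α` on every bond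
   and contour letter `τ`, `‖greenOf P ι h (lev) (a′·lev^d) Γ U i i′‖ ≤ (2/γ_V)·e^{−κ_V·dist_∞(x,x′)/lev}` (`x = i.1.1`, `x′ = i′.1.1`), and the
   standard-contour form `greenOf_entry_decay_contour` (`τ = e^{(d+1)α} − 1`).

HONEST FRAMING (T4-DAG p. 1).  MODEL level: one region, global small field, ℓ²-pairing ∕ entry norms, route = Combes–Thomas (OURS), constants
OURS and crude; NOT [B9] Thm 3.1 ∕ [B5] Prop. 1.2 as printed; nothing printed is a hypothesis; no `def … : Prop`; spine 0/9 unchanged; NOT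
infinite volume ∕ mass gap ∕ Clay.  HONEST DEPENDENCY: continuum YM on T⁴ ⇐ BetaPertH ∧ nine spine estimates (0/9 proved); BetaPertH ⇐ (D1) ∧
(D4) ∧ CAP+tail; G-an2-4 gates asym, D1 and NE2/3/4.  ABSOLUTE RULE kept; no `sorry`.
-/

noncomputable section

open scoped BigOperators ComplexConjugate Matrix Matrix.Norms.L2Operator Kronecker ComplexOrder

namespace Summit.QuantumFields.BalabanUV.T4Continuum.CovariantVectorGreenDecay

open Literature.MathematicalPhysics.QuantumFieldTheory.Balaban1983to89
open Literature.MathematicalPhysics.QuantumFieldTheory.Balaban1983to89.B5Prop11Plancherel (Tor fine unitVec)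
open Literature.MathematicalPhysics.QuantumFieldTheory.Balaban1983to89.B5Prop11Lower (nsq nsq_nonneg)
open Literature.MathematicalPhysics.QuantumFieldTheory.Balaban1983to89.B5Block118 (bpt tstep)
open Literature.MathematicalPhysics.QuantumFieldTheory.Balaban1983to89.B5G183RateUnitTower (lev lev_neZero)
open Literature.MathematicalPhysics.QuantumFieldTheory.Balaban1983to89.Beta.DeltaACombesThomas (ctRowDefect combesThomas_pairwise_inv
  sq_mul_cosh_div_sub_one_le)
open Literature.MathematicalPhysics.QuantumFieldTheory.Balaban1983to89.Beta.DeltaACombesThomasSets (rhoT rhoT_lipschitz rhoT_le_zero_of_mem le_rhoT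
  stencil_osc_of_lipschitz)
open Literature.MathematicalPhysics.QuantumFieldTheory.Balaban1983to89.Beta.TorusG0Decay (ldist)
open Summit.QuantumFields.BalabanUV.T4Continuum
open Summit.QuantumFields.BalabanUV.Beta.AccretiveCombesThomas (nsq_single)
open Summit.QuantumFields.BalabanUV.T4Continuum.ColourCovariantLaplacian (connM)
open Summit.QuantumFields.BalabanUV.T4Continuum.CovariantBlockAveraging (transport ContourSystem contour)
open Summit.QuantumFields.BalabanUV.T4Continuum.CoerciveInverseTower (Coercive isUnit_of_coercive)
open Summit.QuantumFields.BalabanUV.T4Continuum.SubstrateBackgroundTransporters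
open Summit.QuantumFields.BalabanUV.T4Continuum.SubstrateCovariantAveraging (deltaQOf)
open Summit.QuantumFields.BalabanUV.T4Continuum.SubstrateRawSpecies (greenOf)
open Summit.QuantumFields.BalabanUV.T4Continuum.CovariantVectorCoercive (vecOp gammaV coercive_vecOp vecOp_isHermitian isUnit_vecOp)
open Summit.QuantumFields.BalabanUV.T4Continuum.CovariantVectorCTDefects (rhoV Jvec Jvec_nonneg ctRowDefect_vecOp_le)
open Summit.QuantumFields.BalabanUV.T4Continuum.CovariantVectorGreenOfField (deltaQOf_eq_vecOp norm_connM_transV_le norm_transport_transV_contour_le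
  tauStd tauStd_nonneg)

variable {d : ℕ} {o : Type*} [Fintype o] [DecidableEq o]

/-! ## §1 The pairing decay of `V_R⁻¹` for any admissible bond weight -/

section Pairing

variable (n : ℕ) [NeZero n] (M : Fin d → ℕ) [hM : ∀ μ, NeZero (M μ)]
variable {a' α τ κ L : ℝ} {Γ : ContourSystem d n M} {R : Fin d → (Tor (fine n M) × Fin d → Matrix o o ℂ)} {ρ : Tor (fine n M) × Fin d → ℝ}

/-- **PAIRING DECAY OF `V_R⁻¹`**: `|⟨u, V_R⁻¹v⟩| ≤ e^{−κr}/(γ_V − Jvec)·‖u‖‖v‖` for `v` supported in `{ρ ≤ 0}` and `u` in `{ρ ≥ r}` (bond weight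
lifted to colour). [folklore] -/
theorem vecOp_inv_pairing_decay (ha' : 0 < a') (hα : 0 ≤ α) (hτ : 0 ≤ τ) (hR : ∀ ν k, ‖connM (fine n M) ((n : ℕ) : ℂ) R ν k‖ ≤ α)
    (hT : ∀ y j μ (t : Fin n), ‖transport (fine n M) R μ (Γ y j μ t) - 1‖ ≤ τ)
    (hlip : ∀ x μ ν', |ρ (x + unitVec (fine n M) ν', μ) - ρ (x, μ)| ≤ 1 / n)
    (hL : ∀ (y : Tor M) (μ : Fin d) (j j' : Fin d → Fin n) (t t' : Fin n),
      |ρ (bpt n M y j + tstep (fine n M) μ t, μ) - ρ (bpt n M y j' + tstep (fine n M) μ t', μ)| ≤ L)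
    (hκ : 0 ≤ κ) (hJ : Jvec (Fintype.card o) d a' α τ κ L < gammaV (Fintype.card o) d a' α τ)
    {u v : (Tor (fine n M) × Fin d) × o → ℂ} {r : ℝ} (hu : ∀ i, u i ≠ 0 → r ≤ ρ i.1) (hv : ∀ i, v i ≠ 0 → ρ i.1 ≤ 0) :
    ‖star u ⬝ᵥ ((vecOp n M a' Γ R)⁻¹ *ᵥ v)‖
      ≤ Real.exp (-(κ * r)) / (gammaV (Fintype.card o) d a' α τ - Jvec (Fintype.card o) d a' α τ κ L) * (Real.sqrt (nsq u) * Real.sqrt (nsq v)) := by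
  have hγ : 0 < gammaV (Fintype.card o) d a' α τ := lt_of_le_of_lt (Jvec_nonneg (Fintype.card o) d ha'.le hα κ L) hJ
  exact combesThomas_pairwise_inv (vecOp n M a' Γ R) (vecOp_isHermitian n M a' Γ R) (isUnit_vecOp n M ha' hα hτ hR hT hγ) (rhoV n M ρ)
    (coercive_vecOp n M ha' hα hτ hR hT) (ctRowDefect_vecOp_le n M ha'.le hα hτ hR hT hlip hL) hκ hJ hu hv

end Pairing

/-! ## §2 Set-to-set and entry decay with the distance-to-the-source weight -/

section Entry

variable (n : ℕ) [NeZero n] (M : Fin d → ℕ) [hM : ∀ μ, NeZero (M μ)]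
variable {a' α τ κ : ℝ} {Γ : ContourSystem d n M} {R : Fin d → (Tor (fine n M) × Fin d → Matrix o o ℂ)}

/-- the budget at the stencil oscillation `2(d+1)` of the distance weight. [folklore] -/
abbrev JvecT (co d : ℕ) (a' α τ κ : ℝ) : ℝ := Jvec co d a' α τ κ (2 * ((d : ℝ) + 1))

/-- **SET-TO-SET DECAY**: `v` supported on bonds based in `T`, `u` on bonds at sup-distance `≥ n·r` from `T`:
`|⟨u, V_R⁻¹v⟩| ≤ e^{−κr}/(γ_V − JvecT)·‖u‖‖v‖` (needs `2 ≤ n·M_μ`). [folklore] -/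
theorem vecOp_inv_setDecay (ha' : 0 < a') (hα : 0 ≤ α) (hτ : 0 ≤ τ) (h2 : ∀ μ, 2 ≤ fine n M μ)
    (hR : ∀ ν k, ‖connM (fine n M) ((n : ℕ) : ℂ) R ν k‖ ≤ α) (hT : ∀ y j μ (t : Fin n), ‖transport (fine n M) R μ (Γ y j μ t) - 1‖ ≤ τ)
    (T : Finset (Tor (fine n M))) (hTne : T.Nonempty) (hκ : 0 ≤ κ) (hJ : JvecT (Fintype.card o) d a' α τ κ < gammaV (Fintype.card o) d a' α τ)
    {u v : (Tor (fine n M) × Fin d) × o → ℂ} {r : ℝ} (hv : ∀ i, v i ≠ 0 → i.1.1 ∈ T) (hu : ∀ i, u i ≠ 0 → ∀ t ∈ T, (n : ℝ) * r ≤ ldist (fine n M) i.1.1 t) :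
    ‖star u ⬝ᵥ ((vecOp n M a' Γ R)⁻¹ *ᵥ v)‖
      ≤ Real.exp (-(κ * r)) / (gammaV (Fintype.card o) d a' α τ - JvecT (Fintype.card o) d a' α τ κ) * (Real.sqrt (nsq u) * Real.sqrt (nsq v)) := by
  have hn0 : (0 : ℝ) < n := by exact_mod_cast Nat.pos_of_ne_zero (NeZero.ne n)
  have hc : (0 : ℝ) ≤ 1 / n := by positivity
  have hℓ : ∀ (x : Tor (fine n M)) (μ : Fin d) (ν : Fin d),
      |rhoT T hTne (1 / n) (x + unitVec (fine n M) ν, μ) - rhoT T hTne (1 / n) (x, μ)| ≤ 1 / n := by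
    intro x μ ν
    have h := rhoT_lipschitz h2 T hTne (1 / n) x μ ν
    rwa [abs_of_nonneg hc] at h
  have hL : ∀ (y : Tor M) (μ : Fin d) (j j' : Fin d → Fin n) (t t' : Fin n),
      |rhoT T hTne (1 / n) (bpt n M y j + tstep (fine n M) μ t, μ) - rhoT T hTne (1 / n) (bpt n M y j' + tstep (fine n M) μ t', μ)|
        ≤ 2 * ((d : ℝ) + 1) := by
    intro y μ j j' t t'
    have h := stencil_osc_of_lipschitz n M (rhoT T hTne (1 / n)) hc hℓ y μ j j' t t'
    have heq : 2 * (((d : ℝ) + 1) * n) * (1 / n) = 2 * ((d : ℝ) + 1) := by field_simp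
    rwa [heq] at h
  refine vecOp_inv_pairing_decay n M ha' hα hτ hR hT hℓ hL hκ hJ ?_ ?_
  · intro i hi
    have h := le_rhoT T hTne hc (e := i.1) (hu i hi)
    have heq : 1 / (n : ℝ) * (n * r) = r := by field_simp
    rwa [heq] at h
  · intro i hi
    exact rhoT_le_zero_of_mem T hTne hc (hv i hi)

/-- **ENTRY DECAY**: `‖V_R⁻¹(i, i′)‖ ≤ e^{−κ·dist_∞(x,x′)/n}/(γ_V − JvecT)` (`x = i.1.1`, `x′ = i′.1.1`). [folklore] -/
theorem vecOp_inv_entry_decay (ha' : 0 < a') (hα : 0 ≤ α) (hτ : 0 ≤ τ) (h2 : ∀ μ, 2 ≤ fine n M μ)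
    (hR : ∀ ν k, ‖connM (fine n M) ((n : ℕ) : ℂ) R ν k‖ ≤ α) (hT : ∀ y j μ (t : Fin n), ‖transport (fine n M) R μ (Γ y j μ t) - 1‖ ≤ τ)
    (hκ : 0 ≤ κ) (hJ : JvecT (Fintype.card o) d a' α τ κ < gammaV (Fintype.card o) d a' α τ) (i i' : (Tor (fine n M) × Fin d) × o) :
    ‖(vecOp n M a' Γ R)⁻¹ i i'‖
      ≤ Real.exp (-(κ * (ldist (fine n M) i.1.1 i'.1.1 / n))) / (gammaV (Fintype.card o) d a' α τ - JvecT (Fintype.card o) d a' α τ κ) := by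
  have hn0 : (0 : ℝ) < n := by exact_mod_cast Nat.pos_of_ne_zero (NeZero.ne n)
  have h := vecOp_inv_setDecay n M ha' hα hτ h2 hR hT {i'.1.1} (Finset.singleton_nonempty _) hκ hJ
    (u := Pi.single i (1 : ℂ)) (v := Pi.single i' (1 : ℂ)) (r := ldist (fine n M) i.1.1 i'.1.1 / n)
    (fun x hx => by
      have hxe : x = i' := by by_contra hne; exact hx (by simp [hne])
      simp [hxe])
    (fun x hx t ht => by
      have hxe : x = i := by by_contra hne; exact hx (by simp [hne])
      rw [Finset.mem_singleton] at ht
      rw [hxe, ht]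
      have : (n : ℝ) * (ldist (fine n M) i.1.1 i'.1.1 / n) = ldist (fine n M) i.1.1 i'.1.1 := by field_simp
      rw [this])
  have h1 : star (Pi.single i (1 : ℂ)) ⬝ᵥ ((vecOp n M a' Γ R)⁻¹ *ᵥ Pi.single i' (1 : ℂ)) = (vecOp n M a' Γ R)⁻¹ i i' := by
    rw [Matrix.mulVec_single_one, ← Pi.single_star, star_one, single_dotProduct, one_mul, Matrix.col_apply]
  rw [h1, nsq_single, nsq_single, Real.sqrt_one, mul_one, mul_one] at h
  exact h

end Entry

/-! ## §3 The explicit admissible rate -/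

section Rate

/-- the linear-budget constant **`BV co d a′ α τ = 2co·d(1+α) + a′co²(1+τ)²·(2(d+1))²·e^{(2(d+1))²/2}/2·2`** (crude). [folklore] -/
def BV (co d : ℕ) (a' α τ : ℝ) : ℝ :=
  co * d * (1 + α) * 2 + a' * co ^ 2 * (1 + τ) ^ 2 * ((2 * ((d : ℝ) + 1)) ^ 2 * Real.exp ((2 * ((d : ℝ) + 1)) ^ 2 / 2))

/-- `BV ≥ 0`. [folklore] -/
theorem BV_nonneg (co d : ℕ) {a' α τ : ℝ} (ha' : 0 ≤ a') (hα : 0 ≤ α) : 0 ≤ BV co d a' α τ := by unfold BV; positivity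

/-- `cosh(κL) − 1 ≤ κ·(L²e^{L²/2})` for `0 ≤ κ ≤ 1` (from `cosh y − 1 ≤ (y²/2)e^{y²/2}` at `y = κL`, `κ² ≤ κ`). [folklore] -/
theorem cosh_mul_sub_one_le_linear {κ L : ℝ} (hκ0 : 0 ≤ κ) (hκ1 : κ ≤ 1) :
    Real.cosh (κ * L) - 1 ≤ κ * (L ^ 2 * Real.exp (L ^ 2 / 2)) := by
  have h := sq_mul_cosh_div_sub_one_le (n := 1) (κ * L) le_rfl
  simp only [Nat.cast_one, one_pow, one_mul, div_one] at h
  have hκ2 : κ ^ 2 ≤ κ := by nlinarith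
  have hexp : Real.exp ((κ * L) ^ 2 / 2) ≤ Real.exp (L ^ 2 / 2) := by
    refine Real.exp_le_exp.mpr ?_
    have : (κ * L) ^ 2 = κ ^ 2 * L ^ 2 := by ring
    rw [this]
    have hk : κ ^ 2 ≤ 1 := by nlinarith
    nlinarith [sq_nonneg L]
  calc Real.cosh (κ * L) - 1 ≤ (κ * L) ^ 2 / 2 * Real.exp ((κ * L) ^ 2 / 2) := h
    _ ≤ (κ * L) ^ 2 / 2 * Real.exp (L ^ 2 / 2) := mul_le_mul_of_nonneg_left hexp (by positivity)
    _ = κ ^ 2 * (L ^ 2 * Real.exp (L ^ 2 / 2)) / 2 := by ring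
    _ ≤ κ * (L ^ 2 * Real.exp (L ^ 2 / 2)) / 2 := by gcongr
    _ ≤ κ * (L ^ 2 * Real.exp (L ^ 2 / 2)) := by
        have : 0 ≤ κ * (L ^ 2 * Real.exp (L ^ 2 / 2)) := by positivity
        linarith

/-- `κ²e^{κ²/2} ≤ 2κ` on `[0,1]`. [folklore] -/
theorem sq_mul_exp_le_two_mul {κ : ℝ} (hκ0 : 0 ≤ κ) (hκ1 : κ ≤ 1) : κ ^ 2 * Real.exp (κ ^ 2 / 2) ≤ 2 * κ := by
  have hexp : Real.exp (κ ^ 2 / 2) ≤ 2 := by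
    have h1 : κ ^ 2 / 2 ≤ 1 / 2 := by nlinarith
    calc Real.exp (κ ^ 2 / 2) ≤ Real.exp (1 / 2) := Real.exp_le_exp.mpr h1
      _ ≤ 2 := by
          have := Real.exp_one_lt_d9
          have h2 : Real.exp (1 / 2) ^ 2 = Real.exp 1 := by rw [← Real.exp_nat_mul]; norm_num
          nlinarith [Real.exp_pos (1 / 2 : ℝ)]
  calc κ ^ 2 * Real.exp (κ ^ 2 / 2) ≤ κ ^ 2 * 2 := mul_le_mul_of_nonneg_left hexp (sq_nonneg κ)
    _ = (κ * 2) * κ := by ring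
    _ ≤ (1 * 2) * κ := mul_le_mul_of_nonneg_right (mul_le_mul_of_nonneg_right hκ1 zero_le_two) hκ0
    _ = 2 * κ := by ring

/-- **`JvecT κ ≤ BV·κ` for `0 ≤ κ ≤ 1`**. [folklore] -/
theorem Jvec_le_linear (co d : ℕ) {a' α τ : ℝ} (ha' : 0 ≤ a') (hα : 0 ≤ α) {κ : ℝ} (hκ0 : 0 ≤ κ) (hκ1 : κ ≤ 1) :
    JvecT co d a' α τ κ ≤ BV co d a' α τ * κ := by
  rw [JvecT, Jvec, BV, add_mul]
  refine add_le_add ?_ ?_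
  · have h := sq_mul_exp_le_two_mul hκ0 hκ1
    calc (co : ℝ) * d * (1 + α) * (κ ^ 2 * Real.exp (κ ^ 2 / 2)) ≤ co * d * (1 + α) * (2 * κ) := mul_le_mul_of_nonneg_left h (by positivity)
      _ = co * d * (1 + α) * 2 * κ := by ring
  · have h := cosh_mul_sub_one_le_linear (L := 2 * ((d : ℝ) + 1)) hκ0 hκ1
    calc a' * (co : ℝ) ^ 2 * (1 + τ) ^ 2 * (Real.cosh (κ * (2 * ((d : ℝ) + 1))) - 1)
        ≤ a' * co ^ 2 * (1 + τ) ^ 2 * (κ * ((2 * ((d : ℝ) + 1)) ^ 2 * Real.exp ((2 * ((d : ℝ) + 1)) ^ 2 / 2))) :=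
          mul_le_mul_of_nonneg_left h (by positivity)
      _ = _ := by ring

/-- the EXPLICIT admissible rate **`κ_V = min 1 (γ_V/(2(BV + 1)))`**. [folklore] -/
def kappaV (co d : ℕ) (a' α τ : ℝ) : ℝ := min 1 (gammaV co d a' α τ / (2 * (BV co d a' α τ + 1)))

/-- `0 < κ_V` when `γ_V > 0`. [folklore] -/
theorem kappaV_pos (co d : ℕ) {a' α τ : ℝ} (ha' : 0 ≤ a') (hα : 0 ≤ α) (hγ : 0 < gammaV co d a' α τ) : 0 < kappaV co d a' α τ := by
  have hB := BV_nonneg co d ha' hα (τ := τ)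
  unfold kappaV
  exact lt_min zero_lt_one (div_pos hγ (by positivity))

/-- `0 ≤ κ_V ≤ 1`. [folklore] -/
theorem kappaV_nonneg_le_one (co d : ℕ) {a' α τ : ℝ} (ha' : 0 ≤ a') (hα : 0 ≤ α) (hγ : 0 < gammaV co d a' α τ) :
    0 ≤ kappaV co d a' α τ ∧ kappaV co d a' α τ ≤ 1 :=
  ⟨(kappaV_pos co d ha' hα hγ).le, min_le_left _ _⟩

/-- **the rate is admissible**: `JvecT κ_V ≤ γ_V/2`. [folklore] -/
theorem Jvec_kappaV_le (co d : ℕ) {a' α τ : ℝ} (ha' : 0 ≤ a') (hα : 0 ≤ α) (hγ : 0 < gammaV co d a' α τ) :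
    JvecT co d a' α τ (kappaV co d a' α τ) ≤ gammaV co d a' α τ / 2 := by
  set B : ℝ := BV co d a' α τ with hBdef
  have hB : 0 ≤ B := BV_nonneg co d ha' hα
  have hk := kappaV_nonneg_le_one co d ha' hα hγ (τ := τ)
  refine (Jvec_le_linear co d ha' hα hk.1 hk.2).trans ?_
  rw [← hBdef]
  have hle : kappaV co d a' α τ ≤ gammaV co d a' α τ / (2 * (B + 1)) := min_le_right _ _
  calc B * kappaV co d a' α τ ≤ B * (gammaV co d a' α τ / (2 * (B + 1))) := mul_le_mul_of_nonneg_left hle hB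
    _ = gammaV co d a' α τ / 2 * (B / (B + 1)) := by field_simp
    _ ≤ gammaV co d a' α τ / 2 * 1 := mul_le_mul_of_nonneg_left ((div_le_one (by positivity)).mpr (by linarith)) (by positivity)
    _ = gammaV co d a' α τ / 2 := mul_one _

variable (n : ℕ) [NeZero n] (M : Fin d → ℕ) [hM : ∀ μ, NeZero (M μ)]
variable {a' α τ : ℝ} {Γ : ContourSystem d n M} {R : Fin d → (Tor (fine n M) × Fin d → Matrix o o ℂ)}

/-- **ENTRY DECAY AT THE EXPLICIT RATE**: `‖V_R⁻¹(i,i′)‖ ≤ (2/γ_V)·e^{−κ_V·dist_∞(x,x′)/n}`, `(γ_V, κ_V)` depending on `(card o, d, a′, α, τ)` only.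
[folklore] -/
theorem vecOp_inv_entry_decay_explicit (ha' : 0 < a') (hα : 0 ≤ α) (hτ : 0 ≤ τ) (h2 : ∀ μ, 2 ≤ fine n M μ)
    (hR : ∀ ν k, ‖connM (fine n M) ((n : ℕ) : ℂ) R ν k‖ ≤ α) (hT : ∀ y j μ (t : Fin n), ‖transport (fine n M) R μ (Γ y j μ t) - 1‖ ≤ τ)
    (hγ : 0 < gammaV (Fintype.card o) d a' α τ) (i i' : (Tor (fine n M) × Fin d) × o) :
    ‖(vecOp n M a' Γ R)⁻¹ i i'‖
      ≤ 2 / gammaV (Fintype.card o) d a' α τ * Real.exp (-(kappaV (Fintype.card o) d a' α τ * (ldist (fine n M) i.1.1 i'.1.1 / n))) := by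
  have hJ := Jvec_kappaV_le (Fintype.card o) d ha'.le hα hγ (τ := τ)
  have hJ' : JvecT (Fintype.card o) d a' α τ (kappaV (Fintype.card o) d a' α τ) < gammaV (Fintype.card o) d a' α τ := by linarith
  refine (vecOp_inv_entry_decay n M ha' hα hτ h2 hR hT (kappaV_pos _ d ha'.le hα hγ).le hJ' i i').trans ?_
  rw [div_eq_mul_inv, mul_comm]
  refine mul_le_mul_of_nonneg_right ?_ (Real.exp_pos _).le
  rw [div_eq_mul_inv, show (2 : ℝ) * (gammaV (Fintype.card o) d a' α τ)⁻¹ = (gammaV (Fintype.card o) d a' α τ / 2)⁻¹ by rw [inv_div]; ring]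
  exact inv_anti₀ (by linarith) (by linarith)

end Rate

/-! ## §4 The reading at the operator of record `greenOf = (deltaQOf …)⁻¹` -/

section Reading

variable (P : Params) {G : Type*} [GaugeGroup G] (ι : G →* Matrix o o ℂ) {j k : ℕ} (h : j + k = P.K)
variable {a' α τ : ℝ} {Γ : ContourSystem P.d (lev P.L k) (unitMod P)} {U : GaugeField P j G}

/-- **ENTRY DECAY OF `greenOf` AT A REGULAR BACKGROUND**: `lev·dist1(U b) ≤ α` on every bond, contour letter `τ`, `2 ≤ lev·(2L^m)`:
`‖greenOf P ι h (lev) (a′·lev^d) Γ U i i′‖ ≤ (2/γ_V)·e^{−κ_V·dist_∞(x,x′)/lev}` — level-free constants. [folklore] -/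
theorem greenOf_entry_decay_of_regular (hdist : ∀ g : G, ‖ι g - 1‖ = dist1 g) (ha' : 0 < a') (hα : 0 ≤ α) (hτ : 0 ≤ τ)
    (h2 : ∀ μ, 2 ≤ fine (lev P.L k) (unitMod P) μ) (hU : ∀ b : PBond P j, ((lev P.L k : ℕ) : ℝ) * dist1 (U b) ≤ α)
    (hT : ∀ y jj μ (t : Fin (lev P.L k)), ‖transport (fine (lev P.L k) (unitMod P)) (transV (siteIdx P h) ι U) μ (Γ y jj μ t) - 1‖ ≤ τ)
    (hγ : 0 < gammaV (Fintype.card o) P.d a' α τ) (i i' : (Tor (fine (lev P.L k) (unitMod P)) × Fin P.d) × o) :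
    ‖greenOf P ι h ((lev P.L k : ℕ) : ℂ) (a' * ((lev P.L k : ℕ) : ℝ) ^ P.d) Γ U i i'‖
      ≤ 2 / gammaV (Fintype.card o) P.d a' α τ
          * Real.exp (-(kappaV (Fintype.card o) P.d a' α τ * (ldist (fine (lev P.L k) (unitMod P)) i.1.1 i'.1.1 / (lev P.L k : ℕ)))) := by
  rw [greenOf, deltaQOf_eq_vecOp]
  exact vecOp_inv_entry_decay_explicit (lev P.L k) (unitMod P) ha' hα hτ h2 (norm_connM_transV_le P ι h hdist hU) hT hγ i i'

/-- **ENTRY DECAY OF `greenOf` for the standard contour system** (`τ = e^{(d+1)α} − 1`). [folklore] -/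
theorem greenOf_entry_decay_contour (hdist : ∀ g : G, ‖ι g - 1‖ = dist1 g) (ha' : 0 < a') (hα : 0 ≤ α)
    (h2 : ∀ μ, 2 ≤ fine (lev P.L k) (unitMod P) μ) (hU : ∀ b : PBond P j, ((lev P.L k : ℕ) : ℝ) * dist1 (U b) ≤ α)
    (hγ : 0 < gammaV (Fintype.card o) P.d a' α (tauStd P.d α)) (i i' : (Tor (fine (lev P.L k) (unitMod P)) × Fin P.d) × o) :
    ‖greenOf P ι h ((lev P.L k : ℕ) : ℂ) (a' * ((lev P.L k : ℕ) : ℝ) ^ P.d) (contour (lev P.L k) (unitMod P)) U i i'‖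
      ≤ 2 / gammaV (Fintype.card o) P.d a' α (tauStd P.d α)
          * Real.exp (-(kappaV (Fintype.card o) P.d a' α (tauStd P.d α) * (ldist (fine (lev P.L k) (unitMod P)) i.1.1 i'.1.1 / (lev P.L k : ℕ)))) :=
  greenOf_entry_decay_of_regular P ι h hdist ha' hα (tauStd_nonneg P.d hα) h2 hU (norm_transport_transV_contour_le P ι h hdist hα hU) hγ i i'

end Reading

end Summit.QuantumFields.BalabanUV.T4Continuum.CovariantVectorGreenDecay

end
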